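import Summits.NavierStokesRegularity.NavierStokesRegularity.Theorems.ExtremiserTransienceLocalMaximiserExtraction
import Summits.NavierStokesRegularity.NavierStokesRegularity.Theorems.ExtremiserTransienceTwoThirdsDefs
import HarnessLib

/-!
# Route `ExtremiserTransience`, crux `NearExtremalTransiencePerFlow` (stmt-NavierStokesRegularity-26567),
# LINE g10-1 `two_thirds` (ns-idea-10 g10): S1b step 1 — THE TYPICAL SLICES of a violator

`--supports stmt-NavierStokesRegularity-26567 --as helper`.  The slice-level input of S1b `ExtremalExtraction`: the L3 selection
`LocalMaximiser.exists_selected_slices` (p712109) RE-RUN with S1a `TwoThirds.TypicalSelection` (texts of record p719439) in place of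
g9's `Selection`.  What is new: (a) the linear energy growth of late slices in cell units, `∫_{B(y, rλ)} |w|² ≤ (A_F/r_lo²)·M²λ³·r`, from the
landed `FilamentGap.flowFilamentBudget` (`∫_{B(x,ρ)} |u(t)|² ≤ A_F ν² ρ` eventually) and the lower scale lock `λM/ν ≥ r_lo = c_L/Θ'`; (b) the
selection is called with `(R, η, m) = (n+1, 1/(n+1), n+1)`, so the `n`-th slice carries, besides the thick good centre `x₀ n`, a good ball
`IsGoodBallAt (σ n • u (t n)) (M n) (λ n) c r (K/(i+1))` with `dist c (x₀ n) ≤ rλ/2`, `r ∈ [4^i, 2·4^i]`, at every scale `i ≤ n`.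
Everything else (per-flow derivative budget `A`, Leray / Type-I pinning of the ratio `λM/ν`, the sign making the stretching positive,
`EfficientTimesData`) is verbatim the L3 bookkeeping.

HONEST FRAMING: conditional on S1a (a hypothesis); S1a/S1b/S2, the crux ⟨26567⟩ and NS regularity are OPEN; nothing about Navier–Stokes
regularity or blow-up is proved; no summit is proved by a line. [folklore]
-/

noncomputable section

open scoped Topology InnerProductSpace RealInnerProductSpace ENNReal ContDiff
open MeasureTheory Filter Set Metric Function
open Literature.Analysis Literature.Analysis.FluidPDE
open Summit.NavierStokesRegularity.NavierStokesRegularity.Theorems.DepletionLadder.KStar.HalfSpace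
open Summit.NavierStokesRegularity.NavierStokesRegularity.Theorems.DepletionLadder.KStar.BangBang

namespace Summit.NavierStokesRegularity.NavierStokesRegularity.Theorems

-- the summit's namespace repeats the problem name by convention (D-0017)
set_option linter.dupNamespace false

namespace NearExtremalTransiencePerFlow.TwoThirds

section TypicalSlices

open DepletionLadder.KStar
open NearExtremalTransiencePerFlow.ZoneTransversality NearExtremalTransiencePerFlow.MemberSelection
open NearExtremalTransiencePerFlow.LocalMaximiser
open NearExtremalTransiencePerFlow.SparseBangBang (lintegral_iteratedFDeriv_slice_lt_top sqrt_div_bounds_of_lock height_le_two_mul_of_efficient)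

/-- **The TYPICAL selected slices** (S1a `TypicalSelection` run per `n` with `(R, η, m) = (n+1, 1/(n+1), n+1)`; as
`LocalMaximiser.exists_selected_slices` plus the linear growth of late slices `FilamentGap.flowFilamentBudget` in cell units and the
good balls at every scale `i ≤ n`).  Original docstring of the L3 version:  For a violator flow and the thick-good-centre `Selection` there are, for every `n`, a late time
`t n ∈ [max 0 (T − 1/(n+1)), T)`, a height `M n`, a sign `σ n = ±1` and a centre `x₀ n` such that the signed slice
`w n = σ n • u (t n)` is admissible and `A`-regular at its own Taylor length `λ n = lam (w n)` (per-flow budget `A`), near-extremal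
with POSITIVE stretching at deficit `ε' n ≤ 1/(n+1)`, scale-locked (`λ n · M n / ν ∈ [r_lo, r_hi]`, Taylor bound `Z ≤ Θ_T ν(T−t)P`),
thick at `x₀ n` (`‖curl (w n) (x₀ n)‖ ≥ θ₀ M n / λ n`) and `(n+1, 1/(n+1))`-good there (every admissible test in `B(x₀ n, (n+1)λ n)`
gains `≤ M n³/(n+1)`); and the times/heights/deficits form `EfficientTimesData`. -/
theorem exists_typical_slices (hSel : TypicalSelection) {C ν T : ℝ}
    {u : ℝ → EuclideanSpace ℝ (Fin 3) → EuclideanSpace ℝ (Fin 3)} {p : ℝ → EuclideanSpace ℝ (Fin 3) → ℝ}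
    (hV : IsViolator C ν T u p) :
    ∃ (A : ℕ → ℝ) (θ₀ K r_lo r_hi Θ_T : ℝ) (t M lamn ε' : ℕ → ℝ) (x₀ : ℕ → EuclideanSpace ℝ (Fin 3)) (σ : ℕ → ℝ),
      (∀ j, 1 ≤ A j) ∧ 0 < θ₀ ∧ 0 < K ∧ 0 < r_lo ∧ r_lo ≤ r_hi ∧
      (∀ n, T - 1 / (n + 1) ≤ t n) ∧ (∀ n, σ n = 1 ∨ σ n = -1) ∧
      (∀ n, ContDiff ℝ (⊤ : ℕ∞) (fun x => σ n • u (t n) x)) ∧ (∀ n x, ‖σ n • u (t n) x‖ ≤ M n) ∧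
      (∀ n, lamn n = lam (fun x => σ n • u (t n) x)) ∧ (∀ n, 0 < lamn n) ∧
      (∀ n, r_lo ≤ lamn n * M n / ν ∧ lamn n * M n / ν ≤ r_hi) ∧
      (∀ n j x, ‖iteratedFDeriv ℝ j (fun x => σ n • u (t n) x) x‖ ≤ A j * M n * (lamn n)⁻¹ ^ j) ∧
      (∀ n, θ₀ * M n * (lamn n)⁻¹ ≤ ‖curl (fun x => σ n • u (t n) x) (x₀ n)‖) ∧
      (∀ n φ, IsTestAt (fun x => σ n • u (t n) x) (M n) φ → tsupport φ ⊆ Metric.ball (x₀ n) ((n + 1) * lamn n) →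
        locGain (kStar * M n) (lamn n) (fun x => σ n • u (t n) x) φ ≤ 1 / (n + 1) * M n ^ 3) ∧
      (∀ n (i : ℕ), i < n + 1 → ∃ (c : EuclideanSpace ℝ (Fin 3)) (r : ℝ), dist c (x₀ n) ≤ r * lamn n / 2 ∧
        (4 : ℝ) ^ i ≤ r ∧ r ≤ 2 * (4 : ℝ) ^ i ∧ IsGoodBallAt (fun x => σ n • u (t n) x) (M n) (lamn n) c r (K / (i + 1))) ∧
      EfficientTimesData ν T u Θ_T t M ε' := by
  obtain ⟨hC, hν, hT, hsol, hLH, hdec, hrate, hext, hnot⟩ := hV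
  have hsν : 0 < Real.sqrt ν := Real.sqrt_pos.2 hν
  have hK : 0 < kStar := kStar_pos
  -- ### per-flow constants
  obtain ⟨cL, hcL, hler⟩ := DepletionLadder.PerFlow.lerayLowerRate_of_not_extends hν hT hsol hLH hdec hext
  obtain ⟨Cs, hCs⟩ := ExtremiserTransience.higherTypeIRates C ν T hC hν hT u p hsol hLH hdec hrate
  obtain ⟨tA, htA, hsubA⟩ := mem_nhdsLT_iff_exists_Ioo_subset.1 hCs
  have htAT : tA < T := htA
  obtain ⟨tB, htB, hsubB⟩ := mem_nhdsLT_iff_exists_Ioo_subset.1 hrate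
  have htBT : tB < T := htB
  -- linear energy growth of late slices (`FilamentGap.flowFilamentBudget`)
  obtain ⟨A_F0, hAF0⟩ := FilamentGap.flowFilamentBudget C ν T hC hν hT u p hsol hLH hdec hrate
  set A_F : ℝ := max A_F0 1 with hAFdef
  have hAFpos : 0 < A_F := lt_of_lt_of_le one_pos (le_max_right _ _)
  have hAF : ∀ᶠ t' in 𝓝[<] T, ∀ (x : EuclideanSpace ℝ (Fin 3)) (r : ℝ), 0 < r →
      ∫ y in Metric.ball x r, ‖u t' y‖ ^ 2 ≤ A_F * ν ^ 2 * r := by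
    filter_upwards [hAF0] with t' ht' x r hr'
    exact (ht' x r hr').trans (mul_le_mul_of_nonneg_right (mul_le_mul_of_nonneg_right (le_max_left _ _) (sq_nonneg ν)) hr'.le)
  obtain ⟨tF, htF, hsubF⟩ := mem_nhdsLT_iff_exists_Ioo_subset.1 hAF
  have htFT : tF < T := htF
  have hfw := DepletionLadder.flowwise_of_universal DepletionLadder.sharpDepletion_is_universal hν hT hsol hLH hdec
  obtain ⟨c₁, c₂, hc₁, hc₁₂, hlock⟩ :=
    DepletionLadder.PerFlow.scaleLock_at_nearEfficient_times hC hν hT hsol hLH hdec hrate hext hnot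
  set Θ : ℝ := max c₂ c₁⁻¹ with hΘdef
  have hΘpos : 0 < Θ := lt_of_lt_of_le (inv_pos.2 hc₁) (le_max_right _ _)
  have hΘc₂ : c₂ ≤ Θ := le_max_left _ _
  have hΘc₁ : Θ⁻¹ ≤ c₁ := by rw [inv_le_comm₀ hΘpos hc₁]; exact le_max_right _ _
  set Θ' : ℝ := max Θ 1 with hΘ'def
  have hΘ'1 : 1 ≤ Θ' := le_max_right _ _
  have hΘ'pos : 0 < Θ' := lt_of_lt_of_le one_pos hΘ'1
  have hΘΘ' : Θ ≤ Θ' := le_max_left _ _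
  set A : ℕ → ℝ := fun j => max 1 (Cs j * Θ' ^ j / cL) with hAdef
  have hA1 : ∀ j, 1 ≤ A j := fun j => le_max_left _ _
  -- ### Selection at the per-flow budget `A`
  have hrlo_pos : 0 < cL / Θ' := div_pos hcL hΘ'pos
  obtain ⟨θ₀, K, hθ₀, hKpos, hselR⟩ := hSel A hA1 (A_F / (cL / Θ') ^ 2) (by positivity)
  -- ### the step: one good slice past any onset, for any `R, η` and deficit cap
  have step : ∀ n : ℕ, ∃ (t M B : ℝ) (x₀ : EuclideanSpace ℝ (Fin 3)) (σ : ℝ),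
      t ∈ Set.Ico 0 T ∧ T - 1 / (n + 1) ≤ t ∧ (σ = 1 ∨ σ = -1) ∧
      IsAdm (fun x => σ • u t x) M B ∧ IsReg A (fun x => σ • u t x) M ∧ 0 < M ∧ (∀ x, ‖u t x‖ ≤ M) ∧
      0 < lam (u t) ∧ (cL / Θ' ≤ lam (u t) * M / ν ∧ lam (u t) * M / ν ≤ 2 * C * Θ') ∧
      θ₀ * M * (lam (fun x => σ • u t x))⁻¹ ≤ ‖curl (fun x => σ • u t x) x₀‖ ∧
      (∀ φ, IsTestAt (fun x => σ • u t x) M φ → tsupport φ ⊆ Metric.ball x₀ ((n + 1) * lam (fun x => σ • u t x)) →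
        locGain (kStar * M) (lam (fun x => σ • u t x)) (fun x => σ • u t x) φ ≤ 1 / (n + 1) * M ^ 3) ∧
      (∀ i : ℕ, i < n + 1 → ∃ (c : EuclideanSpace ℝ (Fin 3)) (r : ℝ), dist c x₀ ≤ r * lam (fun x => σ • u t x) / 2 ∧
        (4 : ℝ) ^ i ≤ r ∧ r ≤ 2 * (4 : ℝ) ^ i ∧
        IsGoodBallAt (fun x => σ • u t x) M (lam (fun x => σ • u t x)) c r (K / (i + 1))) ∧
      0 < Real.sqrt (∫ x, ‖curl (u t) x‖ ^ 2) * Real.sqrt (∫ x, frobeniusNormSq (fderiv ℝ (curl (u t)) x)) ∧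
      (∃ ε : ℝ, 0 < ε ∧ ε ≤ 1 / (n + 1) ∧
        (kStar - ε) * M * Real.sqrt (∫ x, ‖curl (u t) x‖ ^ 2) * Real.sqrt (∫ x, frobeniusNormSq (fderiv ℝ (curl (u t)) x)) ≤
          |∫ x, ⟪curl (u t) x, fderiv ℝ (u t) x (curl (u t) x)⟫_ℝ|) ∧
      (∫ x, ‖curl (u t) x‖ ^ 2) ≤ c₂ * (ν * (T - t)) * ∫ x, frobeniusNormSq (fderiv ℝ (curl (u t)) x) := by
    intro n
    have hn1 : (0 : ℝ) < n + 1 := by positivity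
    have hRn : (0 : ℝ) < (n : ℝ) + 1 := hn1
    obtain ⟨ε₀, hε₀, hgood⟩ := hselR ((n : ℝ) + 1) (1 / ((n : ℝ) + 1)) (n + 1) hRn (by positivity)
    set ε' : ℝ := min ε₀ (min (kStar / 2) (1 / ((n : ℝ) + 1))) with hε'def
    have hε' : 0 < ε' := lt_min hε₀ (lt_min (half_pos hK) (by positivity))
    have hε'ε₀ : ε' ≤ ε₀ := min_le_left _ _
    have hε'K : ε' ≤ kStar / 2 := (min_le_right _ _).trans (min_le_left _ _)
    have hε'n : ε' ≤ 1 / ((n : ℝ) + 1) := (min_le_right _ _).trans (min_le_right _ _)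
    -- onset
    set t₂ : ℝ := max (max (T - 1 / ((n : ℝ) + 1)) (T / 2)) (max ((tA + T) / 2) (max ((tB + T) / 2) ((tF + T) / 2))) with ht₂def
    have ht₂T : t₂ < T :=
      max_lt (max_lt (by linarith [one_div_pos.2 hn1]) (by linarith)) (max_lt (by linarith) (max_lt (by linarith) (by linarith)))
    have ht₂0 : 0 ≤ t₂ := le_trans (by linarith : (0 : ℝ) ≤ T / 2) ((le_max_right _ _).trans (le_max_left _ _))
    have hne := hlock ε' hε' t₂ ⟨ht₂0, ht₂T⟩
    obtain ⟨t, ht⟩ := nonempty_of_measure_ne_zero hne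
    simp only [Set.mem_setOf_eq] at ht
    obtain ⟨ht, hlockl, hlocku, hcd, hdiv, ⟨B, hB⟩, hb1, hb2, M, hM, hpos, heff⟩ := ht
    have htT : t < T := ht.2
    have hTt : 0 < T - t := sub_pos.2 htT
    have ht₁t : T - 1 / ((n : ℝ) + 1) ≤ t := le_trans ((le_max_left _ _).trans (le_max_left _ _)) ht.1
    have htI : t ∈ Set.Ico 0 T := ⟨ht₂0.trans ht.1, htT⟩
    have htAt : tA < t := lt_of_lt_of_le (by linarith) (((le_max_left _ _).trans (le_max_right _ _)).trans ht.1)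
    have htBt : tB < t :=
      lt_of_lt_of_le (by linarith) ((((le_max_left _ _).trans (le_max_right _ _)).trans (le_max_right _ _)).trans ht.1)
    have htFt : tF < t :=
      lt_of_lt_of_le (by linarith) ((((le_max_right _ _).trans (le_max_right _ _)).trans (le_max_right _ _)).trans ht.1)
    have hsT : 0 < Real.sqrt (T - t) := Real.sqrt_pos.2 hTt
    set Z : ℝ := ∫ x, ‖curl (u t) x‖ ^ 2 with hZdef
    set P : ℝ := ∫ x, frobeniusNormSq (fderiv ℝ (curl (u t)) x) with hPdef
    set J : ℝ := ∫ x, ⟪curl (u t) x, fderiv ℝ (u t) x (curl (u t) x)⟫_ℝ with hJdef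
    set X : ℝ := ν * (T - t) with hXdef
    have hX : 0 < X := mul_pos hν hTt
    have hsXpos : 0 < Real.sqrt X := Real.sqrt_pos.2 hX
    have heffK : (kStar - ε') * M * Real.sqrt Z * Real.sqrt P ≤ |J| := by unfold kStar udcSet; exact heff
    have hMnn : 0 ≤ M := (norm_nonneg _).trans (hM 0)
    have hM0 : 0 < M := by
      rcases hMnn.eq_or_lt with h | h
      · rw [← h, zero_mul, zero_mul] at hpos; exact absurd hpos (lt_irrefl _)
      · exact h
    have hsZ : 0 < Real.sqrt Z := by
      rcases (Real.sqrt_nonneg Z).eq_or_lt with h | h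
      · rw [← h, mul_zero, zero_mul] at hpos; exact absurd hpos (lt_irrefl _)
      · exact h
    have hsP : 0 < Real.sqrt P := by
      rcases (Real.sqrt_nonneg P).eq_or_lt with h | h
      · rw [← h, mul_zero] at hpos; exact absurd hpos (lt_irrefl _)
      · exact h
    have hZ : 0 < Z := Real.sqrt_pos.1 hsZ
    have hP : 0 < P := Real.sqrt_pos.1 hsP
    have hlo : Θ⁻¹ * X * P ≤ Z :=
      le_trans (mul_le_mul_of_nonneg_right (mul_le_mul_of_nonneg_right hΘc₁ hX.le) hP.le) hlockl
    have hup : Z ≤ Θ * X * P :=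
      hlocku.trans (mul_le_mul_of_nonneg_right (mul_le_mul_of_nonneg_right hΘc₂ hX.le) hP.le)
    set L : ℝ := Real.sqrt (Z / P) with hLdef
    obtain ⟨hLU, hLL⟩ := sqrt_div_bounds_of_lock hP hX hΘpos hΘΘ' hΘ'1 hlo hup
    have hL : 0 < L := lt_of_lt_of_le (div_pos hsXpos hΘ'pos) hLL
    have hlamL : lam (u t) = L := rfl
    -- Leray at `t` and the Type-I pinning
    have hpinl : cL * Real.sqrt ν ≤ Real.sqrt (T - t) * M := by
      obtain ⟨xL, hxL⟩ := hler t htI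
      exact hxL.trans (mul_le_mul_of_nonneg_left (hM xL) (Real.sqrt_nonneg _))
    have hsle : Real.sqrt ν / Real.sqrt (T - t) ≤ M / cL := by
      rw [div_le_div_iff₀ hsT hcL]
      calc Real.sqrt ν * cL = cL * Real.sqrt ν := mul_comm _ _
        _ ≤ Real.sqrt (T - t) * M := hpinl
        _ = M * Real.sqrt (T - t) := mul_comm _ _
    set Mt : ℝ := C * Real.sqrt ν / Real.sqrt (T - t) with hMtdef
    have hMt : ∀ x, ‖u t x‖ ≤ Mt := fun x => by
      have h := hsubB ⟨htBt, htT⟩ x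
      rw [hMtdef, le_div_iff₀ hsT, mul_comm]; exact h
    have hJ : |J| ≤ kStar * Mt * Real.sqrt Z * Real.sqrt P := by
      have h := hfw t htI Mt hMt
      unfold kStar udcSet
      exact h
    have hpinu : Real.sqrt (T - t) * M ≤ 2 * C * Real.sqrt ν := by
      have h5 : M ≤ 2 * Mt := height_le_two_mul_of_efficient hK hε'K hM0.le hsZ hsP heffK hJ
      calc Real.sqrt (T - t) * M ≤ Real.sqrt (T - t) * (2 * Mt) := mul_le_mul_of_nonneg_left h5 hsT.le
        _ = 2 * C * Real.sqrt ν := by rw [hMtdef]; field_simp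
    -- the scale ratio `L M / ν ∈ [cL/Θ', 2CΘ']`
    have hsX : Real.sqrt X = Real.sqrt ν * Real.sqrt (T - t) := by rw [hXdef, Real.sqrt_mul hν.le]
    have hνs : Real.sqrt ν * Real.sqrt ν = ν := Real.mul_self_sqrt hν.le
    have hr_lo : cL / Θ' ≤ L * M / ν := by
      rw [div_le_div_iff₀ hΘ'pos hν]
      calc cL * ν = (cL * Real.sqrt ν) * Real.sqrt ν := by rw [mul_assoc, hνs]
        _ ≤ (Real.sqrt (T - t) * M) * Real.sqrt ν := mul_le_mul_of_nonneg_right hpinl hsν.le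
        _ = (Real.sqrt X / Θ') * M * Θ' := by rw [hsX]; field_simp
        _ ≤ L * M * Θ' := by gcongr
    have hr_hi : L * M / ν ≤ 2 * C * Θ' := by
      rw [div_le_iff₀ hν]
      calc L * M ≤ Θ' * Real.sqrt X * M := mul_le_mul_of_nonneg_right hLU hM0.le
        _ = Θ' * (Real.sqrt ν * (Real.sqrt (T - t) * M)) := by rw [hsX]; ring
        _ ≤ Θ' * (Real.sqrt ν * (2 * C * Real.sqrt ν)) := by gcongr
        _ = 2 * C * Θ' * (Real.sqrt ν * Real.sqrt ν) := by ring
        _ = 2 * C * Θ' * ν := by rw [hνs]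
    -- (T1) at `t`: `A`-regularity at the Taylor length
    have hD : ∀ (j : ℕ) (x : EuclideanSpace ℝ (Fin 3)), ‖iteratedFDeriv ℝ j (u t) x‖ ≤
        Cs j * (Real.sqrt ν / Real.sqrt (T - t)) * (Real.sqrt (ν * (T - t)))⁻¹ ^ j := hsubA ⟨htAt, htT⟩
    have hs0 : 0 < Real.sqrt ν / Real.sqrt (T - t) := div_pos hsν hsT
    have hq0 : 0 < (Real.sqrt (ν * (T - t)))⁻¹ := inv_pos.2 hsXpos
    have hqle : (Real.sqrt (ν * (T - t)))⁻¹ ≤ Θ' * L⁻¹ := by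
      rw [← div_eq_mul_inv, le_div_iff₀ hL, inv_mul_le_iff₀ hsXpos, mul_comm]
      exact hLU
    have hCs0 : ∀ j, 0 ≤ Cs j := fun j => by
      by_contra h
      push Not at h
      have h1 := hD j 0
      have h2 : Cs j * (Real.sqrt ν / Real.sqrt (T - t)) * (Real.sqrt (ν * (T - t)))⁻¹ ^ j < 0 :=
        mul_neg_of_neg_of_pos (mul_neg_of_neg_of_pos h hs0) (pow_pos hq0 j)
      linarith [norm_nonneg (iteratedFDeriv ℝ j (u t) 0)]
    have hReg : IsReg A (u t) M := by
      intro j x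
      rw [hlamL]
      calc ‖iteratedFDeriv ℝ j (u t) x‖ ≤ Cs j * (Real.sqrt ν / Real.sqrt (T - t)) * (Real.sqrt (ν * (T - t)))⁻¹ ^ j :=
            hD j x
        _ ≤ Cs j * (M / cL) * (Θ' * L⁻¹) ^ j :=
            mul_le_mul (mul_le_mul_of_nonneg_left hsle (hCs0 j)) (pow_le_pow_left₀ hq0.le hqle j)
              (pow_nonneg hq0.le j) (mul_nonneg (hCs0 j) (div_nonneg hM0.le hcL.le))
        _ = Cs j * Θ' ^ j / cL * M * L⁻¹ ^ j := by rw [mul_pow]; ring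
        _ ≤ A j * M * L⁻¹ ^ j :=
            mul_le_mul_of_nonneg_right (mul_le_mul_of_nonneg_right (le_max_right _ _) hM0.le)
              (pow_nonneg (inv_nonneg.2 hL.le) j)
    have hb0 : ∫⁻ x, ‖iteratedFDeriv ℝ 0 (u t) x‖ₑ ^ 2 < ⊤ := lintegral_iteratedFDeriv_slice_lt_top hν hT hsol hLH hdec htI 0
    have hAdm : IsAdm (u t) M B := ⟨hcd, hdiv, hM, hB, hb0, hb1, hb2⟩
    -- the sign making the stretching positive
    obtain ⟨σ, hσ, hσJ⟩ : ∃ σ : ℝ, (σ = 1 ∨ σ = -1) ∧ σ * J = |J| := by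
      rcases le_total 0 J with h | h
      · exact ⟨1, Or.inl rfl, by rw [one_mul, abs_of_nonneg h]⟩
      · exact ⟨-1, Or.inr rfl, by rw [neg_one_mul, abs_of_nonpos h]⟩
    set w : EuclideanSpace ℝ (Fin 3) → EuclideanSpace ℝ (Fin 3) := fun x => σ • u t x with hwdef
    have hwAdm : IsAdm w M B := isAdm_sign hσ hAdm
    have hwReg : IsReg A w M := isReg_sign hσ hReg
    have hwZ : Zen w = Z := Zen_sign hσ
    have hwW : Wpa w = P := Wpa_sign hσ
    have hwJ : Jst w = |J| := by rw [hwdef, Jst_sign hσ]; exact hσJ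
    have hwlam : lam w = L := by rw [hwdef, lam_sign hσ]; exact hlamL
    have hweff : (kStar - ε') * M * Real.sqrt (Zen w) * Real.sqrt (Wpa w) ≤ Jst w := by
      rw [hwZ, hwW, hwJ]; exact heffK
    -- linear growth of the slice in cell units: `∫_{B(y, rL)} |w|² ≤ A_F ν² rL ≤ (A_F/r_lo²) M² L³ r`
    have hgrowth : ∀ (y : EuclideanSpace ℝ (Fin 3)) (r : ℝ), 0 < r →
        ∫ x in Metric.ball y (r * lam w), ‖w x‖ ^ 2 ≤ A_F / (cL / Θ') ^ 2 * M ^ 2 * lam w ^ 3 * r := by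
      intro y r hr
      rw [hwlam]
      have hnorm : ∀ x, ‖w x‖ ^ 2 = ‖u t x‖ ^ 2 := fun x => by
        rw [hwdef]
        show ‖σ • u t x‖ ^ 2 = ‖u t x‖ ^ 2
        rcases hσ with h | h <;> simp [h]
      simp_rw [hnorm]
      have h1 := hsubF ⟨htFt, htT⟩ y (r * L) (by positivity)
      have h2 : (cL / Θ') * ν ≤ L * M := by rwa [le_div_iff₀ hν] at hr_lo
      have h3 : (cL / Θ') ^ 2 * ν ^ 2 ≤ (L * M) ^ 2 := by
        rw [← mul_pow]; exact pow_le_pow_left₀ (by positivity) h2 2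
      calc ∫ x in Metric.ball y (r * L), ‖u t x‖ ^ 2 ≤ A_F * ν ^ 2 * (r * L) := h1
        _ = (A_F * r * L) * ν ^ 2 := by ring
        _ ≤ (A_F * r * L) * ((L * M) ^ 2 / (cL / Θ') ^ 2) := by
            refine mul_le_mul_of_nonneg_left ?_ (by positivity)
            rw [le_div_iff₀ (by positivity)]; linarith
        _ = A_F / (cL / Θ') ^ 2 * M ^ 2 * L ^ 3 * r := by field_simp
    -- Typical selection at `(R, η, m) = (n+1, 1/(n+1), n+1)`
    obtain ⟨x₀, hthick, htest, htyp⟩ := hgood w M B ε' hwAdm hwReg (by rw [hwZ]; exact hZ) (by rw [hwW]; exact hP) hε'.le hε'ε₀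
      hweff hgrowth
    refine ⟨t, M, B, x₀, σ, htI, ht₁t, hσ, hwAdm, hwReg, hM0, hM, by rw [hlamL]; exact hL, ⟨hr_lo, hr_hi⟩, hthick,
      fun φ hφ hsub => htest φ hφ hsub, fun i hi => htyp i hi, mul_pos hsZ hsP, ⟨ε', hε', hε'n, heffK⟩, hlocku⟩
  -- ### assemble the sequences
  choose t M B x₀ σ htI htn hσ hAdm hReg hM0 hM hlam0 hr hthick htest htyp hpos heff htaylor using step
  choose ε' hε' hε'n heffε using heff
  refine ⟨A, θ₀, K, cL / Θ', 2 * C * Θ', c₂, t, M, fun n => lam (fun x => σ n • u (t n) x), ε', x₀, σ, hA1, hθ₀, hKpos,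
    div_pos hcL hΘ'pos, ?_, htn, hσ, fun n => (hAdm n).1, fun n x => ?_, fun n => rfl, fun n => ?_, fun n => ?_,
    fun n j x => hReg n j x, hthick, fun n φ hφ hsub => htest n φ hφ hsub, fun n i hi => htyp n i hi, ?_⟩
  · -- `cL/Θ' ≤ 2CΘ'` (both bound the same ratio at `n = 0`)
    exact ((hr 0).1.trans (hr 0).2)
  · exact (hAdm n).2.2.1 x
  · show 0 < lam (fun x => σ n • u (t n) x)
    rw [lam_sign (hσ n)]; exact hlam0 n
  · show cL / Θ' ≤ lam (fun x => σ n • u (t n) x) * M n / ν ∧ lam (fun x => σ n • u (t n) x) * M n / ν ≤ 2 * C * Θ'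
    rw [lam_sign (hσ n)]; exact hr n
  · -- `EfficientTimesData`
    refine ⟨htI, ?_, ?_, hM0, hM, hpos, fun n => heffε n, htaylor⟩
    · -- `t n → T`: squeezed between `T − 1/(n+1)` and `T`
      have h1 : Tendsto (fun n : ℕ => T - 1 / ((n : ℝ) + 1)) atTop (𝓝 (T - 0)) :=
        tendsto_const_nhds.sub tendsto_one_div_add_atTop_nhds_zero_nat
      rw [sub_zero] at h1
      exact tendsto_of_tendsto_of_tendsto_of_le_of_le h1 tendsto_const_nhds htn fun n => (htI n).2.le
    · -- `ε' n → 0`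
      exact squeeze_zero (fun n => (hε' n).le) hε'n tendsto_one_div_add_atTop_nhds_zero_nat


end TypicalSlices

end NearExtremalTransiencePerFlow.TwoThirds

end Summit.NavierStokesRegularity.NavierStokesRegularity.Theorems

end
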